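import Literature.NumberTheory.EllipticCurves.CuspFormEpsConj
import Literature.NumberTheory.EllipticCurves.NewformsMultiplicityOneProofs
import HarnessLib

/-!
# Newforms on `Γ₀(N)` have real Fourier coefficients: the involution `f ↦ f^ε = conj f(-z̄)`
# on `S_k(Γ₀(N))` and `K_f ⊆ ℝ` (Shimura 1971, proof of Thm. 3.48; Atkin–Lehner 1970, Thm. 3)

Topic `NumberTheory/EllipticCurves` (trunk EllArithM; companion of `CuspFormEpsConj`, which
treats `Γ₁(N)`, and of `Newforms`). For a normalised newform `f = ∑ aₙ qⁿ ∈ S_k(Γ₀(N))`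
(`IsNewform0`) every Fourier coefficient is real, `\overline{aₙ(f)} = aₙ(f)`; equivalently the
coefficient field `K_f = ℚ(aₙ(f) : n ≥ 1)` (`coeffField f`) lies in `ℝ` (it is in fact totally
real). The classical argument (Shimura 1971, proof of Thm. 3.48 with Thm. 3.41; Diamond–Shurman
Thm. 5.5.3 with Thm. 5.8.2):

1. `epsConj0 f = f ∣[k] J`, `J = diag(-1, 1)`, i.e. `f^ε(z) = \overline{f(-z̄)}`, is again a cusp
   form of level `Γ₀(N)` (`J` normalises `Γ₀(N)`, `conjAct_J_gamma0`), with
   `aₙ(f^ε) = \overline{aₙ(f)}` (`cuspCoeff_epsConj0`) and `T_p f^ε = (T_p f)^ε` for every prime `p`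
   (`epsConj0_heckeT`, by the `q`-expansion of `T_p`, `qExpansion_coeff_heckeT_holds`, whose
   coefficients `1`, `p^{k-1}` are real) — exactly as for `Γ₁(N)` in `CuspFormEpsConj`.
2. For `p ∤ N` the operator `T_p` is self-adjoint for the Petersson product
   (`heckeT_selfAdjoint_holds`, Diamond–Shurman Thm. 5.5.3), so an eigenvalue `T_p f = a f`,
   `f ≠ 0`, is real (`conj_eq_of_heckeT_eq_smul`).
3. Hence `f^ε` is a simultaneous eigenform of the `T_p`, `p ∤ N`, with the *same* eigenvalues
   `\overline{a_p(f)} = a_p(f)` as the newform `f`; by multiplicity one on all of `S_k(Γ₀(N))`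
   (Atkin–Lehner; Knapp 1993, Thm. 9.22 = `mem_span_of_equiv_of_mem_newSubspace0`) `f^ε = c f`,
   and `a₁(f^ε) = \overline{1} = 1 = a₁(f)` gives `c = 1`: `f^ε = f`, i.e. all `aₙ(f)` are real
   (`IsNewform0.epsConj0_eq`, `IsNewform0.conj_cuspCoeff`, `IsNewform0.cuspCoeff_im_eq_zero`,
   `IsNewform0.coeffField_le_realSubfield`).

## Main statements

* `epsConj0`, `epsConj0_apply`, `cuspCoeff_epsConj0`, `epsConj0_heckeT` (the involution);
* `conj_eq_of_heckeT_eq_smul`: eigenvalues of `T_p`, `p ∤ N`, on `S_k(Γ₀(N))` are real;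
* `IsNewform0.epsConj0_eq : f^ε = f`, `IsNewform0.conj_cuspCoeff : conj aₙ(f) = aₙ(f)`,
  `IsNewform0.cuspCoeff_im_eq_zero : im aₙ(f) = 0`, `IsNewform0.coeffField_le_realSubfield :
  K_f ≤ ℝ` (as intermediate fields of `ℂ/ℚ`, `realSubfield = range (ℝ → ℂ)`).

## References

* G. Shimura, *Introduction to the arithmetic theory of automorphic functions*, Publ. Math. Soc.
  Japan 11 (1971), Thm. 3.41, proof of Thm. 3.48 (the involution `ε`).
* A. O. L. Atkin, J. Lehner, *Hecke operators on `Γ₀(m)`*, Math. Ann. 185 (1970), Thm. 3.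
* F. Diamond, J. Shurman, *A first course in modular forms*, GTM 228 (2005), Thm. 5.5.3,
  Thm. 5.8.2.
* A. W. Knapp, *Elliptic curves*, Princeton 1993, Thm. 9.22.
-/

noncomputable section

open scoped MatrixGroups ModularForm ComplexConjugate

open CongruenceSubgroup UpperHalfPlane Matrix.SpecialLinearGroup ConjAct Pointwise

namespace Literature.NumberTheory.EllipticCurves.ModularForms

/-! ### `J = diag(-1, 1)` normalises `Γ₀(N)` -/

section JConj0

variable {N : ℕ}

/-- `J x J ∈ Γ₀(N)` for `x ∈ Γ₀(N)` (`J γ J = (a, -b; -c, d)`). [folklore] -/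
lemma J_mul_mul_J_mem_gamma0 {x : GL (Fin 2) ℝ} (hx : x ∈ (Gamma0 N : Subgroup (GL (Fin 2) ℝ))) :
    J * x * J ∈ (Gamma0 N : Subgroup (GL (Fin 2) ℝ)) := by
  obtain ⟨γ, hγ, rfl⟩ := hx
  exact ⟨jConj γ, jConj_mem_Gamma0 hγ, mapGL_jConj γ⟩

/-- `J⁻¹ Γ₀(N) J = Γ₀(N)` (as subgroups of `GL(2, ℝ)`): the level of `f ∣[k] J` is again `Γ₀(N)`. [folklore] -/
lemma conjAct_J_gamma0 :
    toConjAct (J⁻¹ : GL (Fin 2) ℝ) • (Gamma0 N : Subgroup (GL (Fin 2) ℝ)) = Gamma0 N := by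
  ext x
  rw [J_inv, Subgroup.mem_pointwise_smul_iff_inv_smul_mem, ← toConjAct_inv, J_inv, toConjAct_smul,
    J_inv]
  refine ⟨fun h ↦ ?_, J_mul_mul_J_mem_gamma0⟩
  have := J_mul_mul_J_mem_gamma0 h
  rwa [show J * (J * x * J) * J = x by
    rw [← mul_assoc, ← mul_assoc, J_mul_J, one_mul, mul_assoc, J_mul_J, mul_one]] at this

end JConj0

/-! ### The involution `f ↦ f^ε = f ∣[k] J` on `S_k(Γ₀(N))` -/

section EpsConj0

variable {N : ℕ} {k : ℤ}

/-- **Shimura's `f^ε` on `Γ₀(N)`**: for `f ∈ S_k(Γ₀(N))`, the cusp form `f^ε = f ∣[k] J`, i.e.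
`f^ε(z) = \overline{f(-z̄)}` (`epsConj0_apply`), again of level `Γ₀(N)` because `J = diag(-1, 1)`
normalises `Γ₀(N)` (`conjAct_J_gamma0`); the `Γ₀(N)`-analogue of `epsConj` (`CuspFormEpsConj`).
Shimura 1971, proof of Thm. 3.48: "for `f ∈ S_k(Γ')`, put `f^ε = \overline{f(-z̄)}`. We see easily
that `f^ε ∈ S_k(Γ')`". [cite: Shimura1971, proof of Thm. 3.48] -/
def epsConj0 (f : CuspForm (Gamma0 N) k) : CuspForm (Gamma0 N) k where
  toFun := ⇑f ∣[k] J
  slash_action_eq' γ hγ :=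
    SlashInvariantFormClass.slash_action_eq (CuspForm.translate f J) γ
      (by rw [conjAct_J_gamma0]; exact hγ)
  holo' := (CuspForm.translate f J).holo'
  zero_at_cusps' hc :=
    (CuspForm.translate f J).zero_at_cusps' (by rw [conjAct_J_gamma0]; exact hc)

/-- `f^ε = f ∣[k] J` as functions. [folklore] -/
@[simp] lemma coe_epsConj0 (f : CuspForm (Gamma0 N) k) : ⇑(epsConj0 f) = ⇑f ∣[k] J := rfl

/-- `f^ε(τ) = conj (f (J • τ))`, `J • τ = -conj τ`. [folklore] -/
lemma epsConj0_apply (f : CuspForm (Gamma0 N) k) (τ : ℍ) : epsConj0 f τ = conj (f (J • τ)) := by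
  rw [coe_epsConj0, ModularForm.slash_apply]
  simp

/-- `ε` is additive. [folklore] -/
lemma epsConj0_add (f g : CuspForm (Gamma0 N) k) : epsConj0 (f + g) = epsConj0 f + epsConj0 g := by
  ext τ
  simp [epsConj0_apply]

/-- `ε` is conjugate-linear: `(c f)^ε = conj(c) f^ε`. [folklore] -/
lemma epsConj0_smul (c : ℂ) (f : CuspForm (Gamma0 N) k) :
    epsConj0 (c • f) = conj c • epsConj0 f := by
  ext τ
  simp [epsConj0_apply]

/-- `0^ε = 0`. [folklore] -/
@[simp] lemma epsConj0_zero : epsConj0 (0 : CuspForm (Gamma0 N) k) = 0 := by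
  ext τ
  simp [epsConj0_apply]

/-- `ε` is an involution: `(f^ε)^ε = f` (`J² = 1`). [folklore] -/
@[simp] lemma epsConj0_epsConj0 (f : CuspForm (Gamma0 N) k) : epsConj0 (epsConj0 f) = f := by
  refine DFunLike.ext' ?_
  change (⇑f ∣[k] J) ∣[k] J = ⇑f
  rw [← SlashAction.slash_mul, J_mul_J, SlashAction.slash_one]

variable [NeZero N]

/-- **`aₙ(f^ε) = \overline{aₙ(f)}`** on `Γ₀(N)`: the Fourier coefficients of
`f^ε(z) = \overline{f(-z̄)}` are the complex conjugates of those of `f` (conjugate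
`f(-z̄) = ∑ aₙ e^{2πin(-z̄)}`; Shimura 1971, proof of Thm. 3.48). [folklore] -/
theorem cuspCoeff_epsConj0 (f : CuspForm (Gamma0 N) k) (n : ℕ) :
    cuspCoeff (epsConj0 f) n = conj (cuspCoeff f n) := by
  have key : ∀ τ : ℍ, HasSum
      (fun m ↦ conj ((qExpansion 1 ⇑f).coeff m) • Function.Periodic.qParam 1 (τ : ℂ) ^ m)
      (epsConj0 f τ) := by
    intro τ
    have h := Complex.hasSum_conj'.mpr (hasSum_qExpansion_gamma0 N k f (J • τ))
    rw [epsConj0_apply]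
    convert h using 2 with m
    rw [smul_eq_mul, smul_eq_mul, map_mul, map_pow, conj_qParam_J_smul]
  exact (ModularFormClass.qExpansion_coeff_unique one_pos (one_mem_strictPeriods_gamma0 N)
    key n).symm

/-- In terms of Mathlib's `qExpansion`:
`(qExpansion 1 f^ε).coeff n = conj ((qExpansion 1 f).coeff n)`. [folklore] -/
theorem qExpansion_coeff_epsConj0 (f : CuspForm (Gamma0 N) k) (n : ℕ) :
    (qExpansion 1 ⇑(epsConj0 f)).coeff n = conj ((qExpansion 1 ⇑f).coeff n) :=
  cuspCoeff_epsConj0 f n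

/-- `f^ε = f` iff all Fourier coefficients of `f` are real (Shimura's real form
`W = {f ∈ S_k(Γ₀(N)) | f^ε = f}`). [cite: Shimura1971, proof of Thm. 3.48] -/
theorem epsConj0_eq_self_iff (f : CuspForm (Gamma0 N) k) :
    epsConj0 f = f ↔ ∀ n, conj (cuspCoeff f n) = cuspCoeff f n := by
  rw [eq_iff_forall_cuspCoeff_eq (one_mem_strictPeriods_gamma0 N)]
  simp only [cuspCoeff_epsConj0]

/-- **`(T_p f)^ε = T_p f^ε`** on `S_k(Γ₀(N))` for every prime `p` (`U_p` for `p ∣ N` included):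
both sides have `n`-th Fourier coefficient `\overline{a_{pn}(f)} + 𝟙_{p ∤ N} p^{k-1} \overline{a_{n/p}(f)}`
(`qExpansion_coeff_heckeT_holds`, Diamond–Shurman Prop. 5.2.2 / (5.3), whose structure constants
are real). [cite: Shimura1971, proof of Thm. 3.48] -/
theorem epsConj0_heckeT (p : ℕ) [NeZero p] (hp : p.Prime) (f : CuspForm (Gamma0 N) k) :
    epsConj0 (heckeT (Gamma0 N) k p f) = heckeT (Gamma0 N) k p (epsConj0 f) := by
  refine eq_of_forall_cuspCoeff_eq (one_mem_strictPeriods_gamma0 N) fun n ↦ ?_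
  rw [cuspCoeff_epsConj0]
  change conj ((qExpansion 1 ⇑(heckeT (Gamma0 N) k p f)).coeff n) =
    (qExpansion 1 ⇑(heckeT (Gamma0 N) k p (epsConj0 f))).coeff n
  rw [qExpansion_coeff_heckeT_holds N k f p hp n,
    qExpansion_coeff_heckeT_holds N k (epsConj0 f) p hp n, qExpansion_coeff_epsConj0,
    qExpansion_coeff_epsConj0]
  simp only [map_add, map_mul, apply_ite conj, map_zero, map_zpow₀, map_natCast]

end EpsConj0

/-! ### Eigenvalues of the self-adjoint `T_p`, `p ∤ N`, are real -/

section RealEigenvalue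

variable {N : ℕ} [NeZero N] {k : ℤ}

/-- **An eigenvalue of `T_p`, `p ∤ N`, on `S_k(Γ₀(N))` is real**: if `T_p f = a f` with `f ≠ 0`
then `conj a = a`, since `T_p` is self-adjoint for the Petersson product
(`heckeT_selfAdjoint_holds`, Diamond–Shurman Thm. 5.5.3) and `⟨f, f⟩ ≠ 0`
(`eq_zero_of_peterssonProduct_self_eq_zero`). [cite: DiamondShurman2005, Thm. 5.5.3] -/
theorem conj_eq_of_heckeT_eq_smul {p : ℕ} [NeZero p] (hp : p.Prime) (hpN : ¬ p ∣ N)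
    {f : CuspForm (Gamma0 N) k} (hf : f ≠ 0) {a : ℂ} (ha : heckeT (Gamma0 N) k p f = a • f) :
    conj a = a := by
  have hsa := heckeT_selfAdjoint_holds N k p hp hpN f f
  rw [ha, peterssonProduct_smul_left, peterssonProduct_smul_right] at hsa
  have hff : peterssonProduct (Gamma0 N) k f f ≠ 0 := fun h ↦
    hf (eq_zero_of_peterssonProduct_self_eq_zero k f h)
  exact mul_right_cancel₀ hff hsa

end RealEigenvalue

/-! ### Newforms: `f^ε = f`, real coefficients, `K_f ⊆ ℝ` -/

section Newform

variable {N : ℕ} [NeZero N] {k : ℤ} {f : CuspForm (Gamma0 N) k}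

omit [NeZero N] in
/-- A normalised form is nonzero (`a₁(f) = 1`). [folklore] -/
theorem IsNormalized.ne_zero_gamma0 {f : CuspForm (Gamma0 N) k} (h1 : IsNormalized f) : f ≠ 0 := by
  intro hf
  have h : (qExpansion 1 ⇑((0 : ℂ) • f)).coeff 1 = 0 * (qExpansion 1 ⇑f).coeff 1 :=
    qExpansion_coeff_smul N k 0 f 1
  rw [zero_smul, zero_mul, ← hf, show (qExpansion 1 ⇑f).coeff 1 = 1 from h1] at h
  exact one_ne_zero h

/-- For a newform `f` on `Γ₀(N)` the Hecke eigenvalues `a_p(f)`, `p ∤ N` prime, are real. [folklore] -/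
theorem IsNewform0.conj_cuspCoeff_of_not_dvd (hf : IsNewform0 f) {p : ℕ} (hp : p.Prime)
    (hpN : ¬ p ∣ N) : conj (cuspCoeff f p) = cuspCoeff f p := by
  haveI : NeZero p := ⟨hp.ne_zero⟩
  exact conj_eq_of_heckeT_eq_smul hp hpN (IsNormalized.ne_zero_gamma0 hf.2.2) (hf.heckeT_eq_coeff_smul hp)

/-- **`f^ε = f` for a newform `f ∈ S_k(Γ₀(N))`.** `f^ε` satisfies `T_p f^ε = \overline{a_p(f)} f^ε =
a_p(f) f^ε` for all primes `p ∤ N` (`epsConj0_heckeT`, `IsNewform0.conj_cuspCoeff_of_not_dvd`), so by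
multiplicity one on `S_k(Γ₀(N))` (Knapp 1993, Thm. 9.22; `mem_span_of_equiv_of_mem_newSubspace0`)
`f^ε = c f`; comparing `a₁(f^ε) = 1 = a₁(f)` gives `c = 1` (Shimura 1971, proof of Thm. 3.48;
Atkin–Lehner 1970, Thm. 3). [cite: Shimura1971, proof of Thm. 3.48] -/
theorem IsNewform0.epsConj0_eq (hf : IsNewform0 f) : epsConj0 f = f := by
  have hf0 : f ≠ 0 := IsNormalized.ne_zero_gamma0 hf.2.2
  have hfT : ∀ (p : ℕ) (hp : p.Prime), ¬ p ∣ N →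
      (haveI : NeZero p := ⟨hp.ne_zero⟩; heckeT (Gamma0 N) k p f) = cuspCoeff f p • f := by
    intro p hp _
    haveI : NeZero p := ⟨hp.ne_zero⟩
    exact hf.heckeT_eq_coeff_smul hp
  have hgT : ∀ (p : ℕ) (hp : p.Prime), ¬ p ∣ N →
      (haveI : NeZero p := ⟨hp.ne_zero⟩; heckeT (Gamma0 N) k p (epsConj0 f)) =
        cuspCoeff f p • epsConj0 f := by
    intro p hp hpN
    haveI : NeZero p := ⟨hp.ne_zero⟩
    rw [← epsConj0_heckeT p hp f, hf.heckeT_eq_coeff_smul hp, epsConj0_smul]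
    change conj (cuspCoeff f p) • epsConj0 f = cuspCoeff f p • epsConj0 f
    rw [hf.conj_cuspCoeff_of_not_dvd hp hpN]
  have hmem := mem_span_of_equiv_of_mem_newSubspace0 hf0 hf.1 hfT (epsConj0 f) hgT
  obtain ⟨c, hc⟩ := Submodule.mem_span_singleton.mp hmem
  have h1 : cuspCoeff f 1 = 1 := hf.2.2
  have hc1 : c = 1 := by
    have h : cuspCoeff (c • f) 1 = cuspCoeff (epsConj0 f) 1 := by rw [hc]
    rw [cuspCoeff_epsConj0, h1, map_one] at h
    change (qExpansion 1 ⇑(c • f)).coeff 1 = 1 at h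
    rw [qExpansion_coeff_smul,
      show (qExpansion 1 ⇑f).coeff 1 = 1 from h1, mul_one] at h
    exact h
  rw [← hc, hc1, one_smul]

/-- **The Fourier coefficients of a newform on `Γ₀(N)` are real**: `\overline{aₙ(f)} = aₙ(f)` for all
`n` (Shimura 1971, proof of Thm. 3.48 with Thm. 3.41; Atkin–Lehner 1970, Thm. 3: the eigenvalues
of the `T_p`, `p ∤ N`, are real by self-adjointness and determine the newform).
[cite: Shimura1971, proof of Thm. 3.48] -/
theorem IsNewform0.conj_cuspCoeff (hf : IsNewform0 f) (n : ℕ) : conj (cuspCoeff f n) = cuspCoeff f n :=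
  (epsConj0_eq_self_iff f).mp hf.epsConj0_eq n

/-- The Fourier coefficients of a newform on `Γ₀(N)` have vanishing imaginary part. [folklore] -/
theorem IsNewform0.cuspCoeff_im_eq_zero (hf : IsNewform0 f) (n : ℕ) : (cuspCoeff f n).im = 0 :=
  Complex.conj_eq_iff_im.mp (hf.conj_cuspCoeff n)

/-- The Fourier coefficients of a newform on `Γ₀(N)` are real numbers: `aₙ(f) = re aₙ(f)`. [folklore] -/
theorem IsNewform0.cuspCoeff_eq_ofReal_re (hf : IsNewform0 f) (n : ℕ) :
    cuspCoeff f n = ((cuspCoeff f n).re : ℂ) :=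
  (Complex.conj_eq_iff_re.mp (hf.conj_cuspCoeff n)).symm

/-- The subfield `ℝ ⊆ ℂ` as an intermediate field of `ℂ/ℚ` (the range of `ℝ → ℂ`). [folklore] -/
def realSubfield : IntermediateField ℚ ℂ :=
  { Complex.ofRealHom.fieldRange with
    algebraMap_mem' := fun q ↦ ⟨q, by simp⟩ }

/-- Membership in `realSubfield`: `z ∈ ℝ ⊆ ℂ` iff `im z = 0`. [folklore] -/
theorem mem_realSubfield_iff {z : ℂ} : z ∈ realSubfield ↔ z.im = 0 := by
  change z ∈ Complex.ofRealHom.fieldRange ↔ _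
  rw [RingHom.mem_fieldRange]
  constructor
  · rintro ⟨x, rfl⟩; simp
  · intro h; exact ⟨z.re, Complex.ext (by simp) (by simp [h])⟩

/-- **The coefficient field of a newform on `Γ₀(N)` is real**: `K_f = ℚ(aₙ(f) : n) ⊆ ℝ`
(Shimura 1971, Thm. 3.48 / Prop. 3.56: `K_f` is totally real for trivial character; here only
`K_f ⊆ ℝ` for the given complex embedding). [cite: Shimura1971, proof of Thm. 3.48] -/
theorem IsNewform0.coeffField_le_realSubfield (hf : IsNewform0 f) : coeffField f ≤ realSubfield := by
  rw [coeffField, IntermediateField.adjoin_le_iff]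
  rintro _ ⟨n, rfl⟩
  exact mem_realSubfield_iff.mpr (hf.cuspCoeff_im_eq_zero n)

/-- Elements of the coefficient field of a newform on `Γ₀(N)` are real. [folklore] -/
theorem IsNewform0.im_eq_zero_of_mem_coeffField (hf : IsNewform0 f) {z : ℂ} (hz : z ∈ coeffField f) :
    z.im = 0 :=
  mem_realSubfield_iff.mp (hf.coeffField_le_realSubfield hz)

end Newform

end Literature.NumberTheory.EllipticCurves.ModularForms
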